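import Summits.BirchSwinnertonDyer.BirchSwinnertonDyer.Theorems.SignedLowerHalvesSmallImageLowerHalfBothSignsLambdaLowerThreeNsTamagawa
import Summits.BirchSwinnertonDyer.BirchSwinnertonDyer.Theorems.SignedLowerHalvesSmallImageLowerHalfBothSignsLambdaLowerThreeNsParity
import HarnessLib

/-!
# Route `SignedLowerHalves` (K3), child crux L `SmallImageLowerHalfBothSigns` (item stmt-BirchSwinnertonDyer-23599),
# line `birth_acns`, stub `stub_lambdaLowerThree_ns` (= retired item 23118 `SmallImageLambdaLowerAtThree`, VERBATIM):
# the stub BY NAME with NO LOCUS BINDER — ⟸ Kobayashi Thm. 1.2 / 4.1 / 6.2–7.3 ∧ B. D. Kim 2013 Cor. 3.15 ∧ period units ∧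
# `p`-parity at `3` ∧ AFE(3) on the class ∧ the `T = 0` SHADOW asked ONLY at rank-`0` `(0,2)`-pairs WITHOUT a split
# multiplicative prime ∧ the rest (cell `bsd-ssimc`, width seat `bsd-line-slh-p3-w3` gen 5; by-name helper `--supports 23599`)

HONEST FRAMING: CALIBRATION / SUPPORT ONLY. The stub is OPEN MATHEMATICS (w3 g0 `stub-blocked`); nothing here closes it;
BSD / child L / the stub are NOT proved. Conditional on DISPLAYED binders: published named facts (`h12`, `h41`, `hK13`,
`hCK`, `h5`, `h3`, `p_parity · 3`), the algebraic functional equation of `Sel^ε(E/ℚ_∞)` at `p = 3` on the small-image X7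
class (`hAFE3` — B. D. Kim 2008 Thm. 3.12 with its printed `p > 3` deleted: the tree's TYPING REQUEST, routed to typer
`bsd-ssimc-ty1` §C, NOT asserted here), and the residue of the stub itself. THEOREMS ONLY; no definition, no named fact,
no `sorry`. Compared with w3 g4's `SmallImageLambdaLowerThreeNsAFEResidue.smallImageLambdaLowerAtThree_of_loci_of_afe_of_shadow_of_residue`:
(i) the two unrefereed LOCUS BINDERS `hFW` (`FouquetWan2021_thm51_via_kobayashi74_OPEN`) and `hBSTW`
(`BurungaleSkinnerTianWan2024_thm13_twist_OPEN`) are GONE — both loci are EMPTY on crux L's domain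
(`SmallImageLambdaLowerThreeNsTamagawa.not_fwLocus_of_irr_of_not_surj` / `not_twistLocus_of_irr_of_not_surj`, §1 below),
so they bound nothing; (ii) the `T = 0` shadow clause `hshadow` is asked ONLY at pairs with NO split multiplicative prime
(at a split multiplicative `ℓ`, `3 ∣ c_ℓ = ord_ℓ(Δ_min)` because the small image kills (ram),
`SmallImageLambdaLowerThreeNsTamagawa.dvd_tamagawaProduct_of_split`).

## What is proved

* §1 `loci_clauses_of_classX7` — at every small-image X7 pair (`p ≠ 2`) the `hloc` AND `htw` clauses of w3 g0/g3/g4's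
  residue theorems HOLD (both loci are empty): the loci binders were idle for this stub.
* §2 `smallImageLambdaLowerAtThree_of_afe_of_nonsplitShadow_of_residue` — the stub BY NAME from `h12 h41 hCK hK13 h5 h3`,
  `hpar3`, `hAFE3`, and THREE residue clauses at the `p = 3`, X7, ¬CM, `a_3 = 0`, ¬Surj pairs:
  `hshadow` — rank `0`, certificate `(μ, λ)(L_3^ε) = (0, 2)`, and NO split multiplicative prime: «`3 ∣ ∏ c_ℓ · #Sel_{3^∞}(E/ℚ)`»;
  `hres0` — rank `0`, certificate not `(0, 2)`, `corank + 2 ≤ λ(L_3^ε)`: «`λ(L_3^ε) ≤ λ(ξ^ε) + 1`»;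
  `hres1` — `Sel_{3^∞}(E/ℚ)` infinite, `corank + 2 ≤ λ(L_3^ε)`: «`λ(L_3^ε) ≤ λ(ξ^ε)`».
  Proof: w3 g0's `smallImageLambdaLowerAtThree_iff_lamLe'` (no loci), the corank squeeze + g3's μ-free parity for
  `λ(L) ≤ corank + 1`, this gen's split-prime closer / `hshadow` on the `(0, 2)` stratum, g4's widened door otherwise.
READING (numbers, not adjectives; W-plan-12 v5 window: 100 small-image `p = 3` X7 pairs, 96 of rank `0`): modulo AFE(3) and
print, the rank-`0` `(0, 2)`-certified sub-stratum of the stub is CLOSED at every pair with a split multiplicative prime,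
and at the others it is «`3 ∣ c_2·#Ш[3^∞]`»-shaped (`c_ℓ ∈ {1, 2}` at non-split `ℓ`; `c_ℓ ∈ {1, 2, 4}` at additive `ℓ ≥ 5`
once `3 ∣ ord_ℓ(Δ_min)` — a Kodaira–Néron reading, not used here); the engine territory (`λ(L_3^ε) ≥ λ(ξ^ε) + 2` in
rank `0`, corank `≥ 1`) is unchanged.

References: [KimBD2008MRL] Thm. 3.12 (p. 93); [Kobayashi2003] Thm. 1.2, Thm. 4.1 (p. 8), Conjecture (p. 2); [BDKim2013]
Cor. 3.15 (p. 199); [DokchitserDokchitserAnnals2010] Thm. 1.4, Cor. 4.20; [Sprung2017] Cor. 4.14; [Serre1972] Prop. 12, 15, 21;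
[SilvermanATAEC1994] Cor. IV.9.2(d); [FouquetWan2021] Thm. 5.1 (PRE); [BurungaleSkinnerTianWan2024] Thm. 1.3 (PRE).
-/

set_option autoImplicit false
-- D-0017: single-problem summit, the namespace repeats the problem name by design.
set_option linter.dupNamespace false

noncomputable section

open scoped Classical MatrixGroups ModularForm

open CongruenceSubgroup PowerSeries WeierstrassCurve Field Literature.NumberTheory.EllipticCurves
  Literature.NumberTheory.EllipticCurves.ModularForms
  Literature.NumberTheory.EllipticCurves.Rank1Residual
  Literature.NumberTheory.EllipticCurves.Kobayashi2003 ZpExtension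
  Literature.NumberTheory.EllipticCurves.Rank1Residual.Typed
  Summit.BirchSwinnertonDyer.Rank1Residual
  Summit.BirchSwinnertonDyer.Rank1Residual.X1.MuLambda
  Summit.BirchSwinnertonDyer.Rank1Residual.Supersingular

namespace Summit.BirchSwinnertonDyer.BirchSwinnertonDyer.Theorems.SmallImageLambdaLowerThreeNsTamagawaResidue

open SmallImageLambdaLowerThreeNsDoor SmallImageLambdaLowerThreeNs SmallImageLambdaParityMuFree
  SmallImageLambdaLowerThreeNsParity SmallImageLambdaLowerThreeNsAFE SmallImageLambdaLowerThreeNsAFEClosure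
  SmallImageLambdaLowerThreeNsTamagawa

/-! ## §1. On crux L's domain both locus clauses hold: the loci binders were idle -/

/-- **Both LOCUS CLAUSES of w3 g0/g3/g4's residue theorems HOLD at every small-image X7 pair** (`p ≠ 2`, `ClassX7 W p`,
`ρ̄_{E,p}` not onto): the Fouquet–Wan clause `hloc` (no non-split multiplicative `ℓ ≠ p` with `p ∤ ord_ℓ(Δ_min)`) and the
BSTW-twist clause `htw` (not a quadratic twist of a semistable curve supersingular at `p`). So the binders
`FouquetWan2021_thm51_via_kobayashi74_OPEN` / `BurungaleSkinnerTianWan2024_thm13_twist_OPEN` were never invoked on this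
stub's pairs. [claim: FouquetWan2021, status: under-review] [claim: BurungaleSkinnerTianWan2024, status: under-review]
[cite: Serre1972, §1.11 Prop. 12, §2.4 Prop. 15, §5.4 Prop. 21] -/
theorem loci_clauses_of_classX7 (W : WeierstrassCurve ℚ) [W.IsElliptic] [W.IsGloballyMinimal] (p : ℕ) [Fact p.Prime]
    (hp : p ≠ 2) (hX : ClassX7 W p) (hs : ¬ Surj W p) :
    (¬ ∃ (ℓ : ℕ) (_ : Fact ℓ.Prime), ℓ ≠ p ∧ W.HasMultiplicativeReductionAtPrime ℓ ∧
        ¬ W.HasSplitMultiplicativeReductionAtPrime ℓ ∧ ¬ p ∣ padicValInt ℓ W.minimalDiscriminantInt) ∧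
    (¬ ∃ (W₀ : WeierstrassCurve ℚ) (_ : W₀.IsElliptic) (_ : W₀.IsGloballyMinimal)
        (K : Type) (_ : Field K) (_ : NumberField K),
        Semistable W₀ ∧ GoodSS W₀ p ∧ (p = 3 → W₀.frobeniusTrace 3 = 0) ∧ Module.finrank ℚ K = 2 ∧
        IsCoprime (NumberField.discr K) ((W₀.conductorNorm ℤ * p : ℕ) : ℤ) ∧
        (∀ (ℓ : ℕ) [Fact ℓ.Prime], (ℓ : ℤ) ∣ NumberField.discr K → GoodOrd W₀ ℓ) ∧
        ∃ C : VariableChange ℚ, C • W₀.quadraticTwist (NumberField.discr K : ℚ) = W) :=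
  ⟨not_fwLocus_of_irr_of_not_surj W p (ClassX7.irr W p hp hX) hs,
    not_twistLocus_of_irr_of_not_surj W p hp (ClassX7.irr W p hp hX) hs⟩

/-! ## §2. The re-cut: NO locus binder, the `T = 0` shadow only at pairs without a split multiplicative prime -/

/-- **The stub BY NAME from Kobayashi Thm. 1.2 / 4.1 / 6.2–7.3, B. D. Kim 2013 Cor. 3.15, the period units, `p`-parity at `3`,
the algebraic functional equation at `3` on the class, the `T = 0` shadow on the rank-`0` `(0, 2)`-certified pairs WITHOUT
a split multiplicative prime, and the rest of the paired-excess residue — NO LOCUS BINDER.** Hypotheses BY NAME: `h12`,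
`h41` (rational display), `hCK`, `hK13`, `h5`, `h3`, `hpar3` (Dokchitser–Dokchitser at `p = 3`), `hAFE3` (`ι(Char X^ε) = Char X^ε`
for every dual datum at every `p = 3`, X7, ¬CM, `a_3 = 0`, ¬Surj pair — Kim 2008 Thm. 3.12 with `p > 3` deleted: a
HYPOTHESIS), and, per pair / frame / newform / Pollack pair: `hshadow` (rank `0`, `(μ, λ)(L_3^ε) = (0, 2)`, EVERY
multiplicative prime of `E` non-split: `3 ∣ ∏ c_ℓ · #Sel_{3^∞}(E/ℚ)`), `hres0` (rank `0`, certificate not `(0, 2)`,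
`corank + 2 ≤ λ`: `λ(L_3^ε) ≤ λ(ξ^ε) + 1`), `hres1` (`Sel_{3^∞}(E/ℚ)` infinite, `corank + 2 ≤ λ`: `λ(L_3^ε) ≤ λ(ξ^ε)`).
Proof: `smallImageLambdaLowerAtThree_iff_lamLe'` (w3 g0; `h12 h41 h3`, no loci); per pair: `λ(L) ≤ corank + 1` ⟹
`λ(L) ≤ corank ≤ λ(ξ)` (g3's μ-free parity `selmerCorank_add_two_le_lam_of_lt` + g0's `selmerCorank_le_lam_charGen`);
else rank `0` & `(0, 2)`: this gen's `lam_kobayashiL_le_lam_charGen_of_cert_of_split` at a split prime, `hshadow` + g4's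
`…_of_cert_of_not_surj` otherwise; rank `0` & not `(0, 2)`: g4's widened door; positive corank: `hres1`. CALIBRATION ONLY.
[cite: Kobayashi2003, Thm. 1.2, Thm. 4.1 (p. 8), Thm. 6.2–6.3, Thm. 7.3 (7.21), Conjecture (p. 2)]
[cite: KimBD2008MRL, Thm. 3.12 (p. 93) and §1 p. 83] [cite: BDKim2013, Cor. 3.15 (p. 199)]
[cite: DokchitserDokchitserAnnals2010, Thm. 1.4 and Cor. 4.20] [cite: Sprung2017, Cor. 4.14 (a_p = 0 display)]
[cite: SilvermanATAEC1994, Cor. IV.9.2(d)] [cite: Serre1972, §2.4 Prop. 15] -/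
theorem smallImageLambdaLowerAtThree_of_afe_of_nonsplitShadow_of_residue
    (h12 : Kobayashi2003.thm12_signedSelmerDual_finite_torsion)
    (h41 : Kobayashi2003.thm41_signedCharIdeal_divisibility)
    (hCK : Kobayashi2003.thm62_63_73_signedColemanKato_zeta)
    (hK13 : BDKim2013.cor315_signedCharValue_rankZero)
    (h5 : realPeriodRat_eq_unit_mul_plusPeriod) (h3 : realPeriodRat_eq_unit_mul_plusPeriod_three)
    (hpar3 : ∀ (W : WeierstrassCurve ℚ) [W.IsElliptic], p_parity W 3)
    (hAFE3 : ∀ (W : WeierstrassCurve ℚ) [W.IsElliptic] [W.IsGloballyMinimal] (p : ℕ) [Fact p.Prime],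
      p = 3 → ClassX7 W p → ¬ W.HasCM → W.frobeniusTrace p = 0 → ¬ Surj W p →
      ∀ (κ : ZpExtension ℚ p) (γ : absoluteGaloisGroup ℚ), κ.IsCyclotomic → κ.IsTopGenerator γ →
      ∀ (ε : ℤˣ) (D : SignedSelmerDualData W κ γ ε),
        Ideal.map (IwasawaAlgebra.invol p) D.charIdeal = D.charIdeal)
    (hshadow : ∀ (W : WeierstrassCurve ℚ) [W.IsElliptic] [W.IsGloballyMinimal] (p : ℕ) [Fact p.Prime],
      p = 3 → ClassX7 W p → ¬ W.HasCM → W.frobeniusTrace p = 0 → ¬ Surj W p →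
      (∀ (ℓ : ℕ) [Fact ℓ.Prime], ¬ W.HasSplitMultiplicativeReductionAtPrime ℓ) →
      ∀ (ε : ℤˣ) (κ : ZpExtension ℚ p) (γ : absoluteGaloisGroup ℚ),
          κ.IsCyclotomic → κ.IsTopGenerator γ → IsCyclotomicVariable p γ →
        ∀ [NeZero (W.conductorNorm ℤ)] (f : CuspForm (Gamma0 (W.conductorNorm ℤ)) 2), IsNewformOf W f →
        ∀ (Lplus Lminus : IwasawaAlgebra p), IsPollackPair f p Lplus Lminus →
          Finite (W.selmerGroupPInfty p) →
          mu (kobayashiL ε Lplus Lminus) = 0 → lam (kobayashiL ε Lplus Lminus) = 2 →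
        p ∣ W.tamagawaProduct * Nat.card (W.selmerGroupPInfty p))
    (hres0 : ∀ (W : WeierstrassCurve ℚ) [W.IsElliptic] [W.IsGloballyMinimal] (p : ℕ) [Fact p.Prime],
      p = 3 → ClassX7 W p → ¬ W.HasCM → W.frobeniusTrace p = 0 → ¬ Surj W p →
      ∀ (ε : ℤˣ) (κ : ZpExtension ℚ p) (γ : absoluteGaloisGroup ℚ),
          κ.IsCyclotomic → κ.IsTopGenerator γ → IsCyclotomicVariable p γ →
        ∀ [NeZero (W.conductorNorm ℤ)] (f : CuspForm (Gamma0 (W.conductorNorm ℤ)) 2), IsNewformOf W f →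
        ∀ (Lplus Lminus : IwasawaAlgebra p), IsPollackPair f p Lplus Lminus →
          Finite (W.selmerGroupPInfty p) →
          ¬ (mu (kobayashiL ε Lplus Lminus) = 0 ∧ lam (kobayashiL ε Lplus Lminus) = 2) →
          W.selmerCorank p + 2 ≤ lam (kobayashiL ε Lplus Lminus) →
        ∀ (D : SignedSelmerDualData W κ γ ε) (ξ : IwasawaAlgebra p), D.charIdeal = Ideal.span {ξ} →
          lam (kobayashiL ε Lplus Lminus) ≤ lam ξ + 1)
    (hres1 : ∀ (W : WeierstrassCurve ℚ) [W.IsElliptic] [W.IsGloballyMinimal] (p : ℕ) [Fact p.Prime],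
      p = 3 → ClassX7 W p → ¬ W.HasCM → W.frobeniusTrace p = 0 → ¬ Surj W p →
      ∀ (ε : ℤˣ) (κ : ZpExtension ℚ p) (γ : absoluteGaloisGroup ℚ),
          κ.IsCyclotomic → κ.IsTopGenerator γ → IsCyclotomicVariable p γ →
        ∀ [NeZero (W.conductorNorm ℤ)] (f : CuspForm (Gamma0 (W.conductorNorm ℤ)) 2), IsNewformOf W f →
        ∀ (Lplus Lminus : IwasawaAlgebra p), IsPollackPair f p Lplus Lminus →
          ¬ Finite (W.selmerGroupPInfty p) → W.selmerCorank p + 2 ≤ lam (kobayashiL ε Lplus Lminus) →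
        ∀ (D : SignedSelmerDualData W κ γ ε) (ξ : IwasawaAlgebra p), D.charIdeal = Ideal.span {ξ} →
          lam (kobayashiL ε Lplus Lminus) ≤ lam ξ) :
    Summit.BirchSwinnertonDyer.BirchSwinnertonDyer.Theses.SignedLowerHalves.SmallImageLambdaLowerAtThree := by
  refine (smallImageLambdaLowerAtThree_iff_lamLe' h12 h41 h3).mpr ?_
  intro W _ _ p _ hp3 hX hCM hap hs ε κ γ hκ hγ hγ' _ f hf Lplus Lminus hPP D ξ hξ
  have hp : p ≠ 2 := by rw [hp3]; decide
  have hparW : p_parity W p := by subst hp3; exact hpar3 W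
  by_cases h2 : W.selmerCorank p + 2 ≤ lam (kobayashiL ε Lplus Lminus)
  swap
  · -- the corank squeeze widened by one: `λ(L) ≤ corank + 1` forces `λ(L) ≤ corank ≤ λ(ξ)`
    have hle : lam (kobayashiL ε Lplus Lminus) ≤ W.selmerCorank p := by
      by_contra hlt
      exact h2 (selmerCorank_add_two_le_lam_of_lt W p hparW hp hX.1.1 hap hf hPP ε (not_le.mp hlt))
    exact hle.trans (selmerCorank_le_lam_charGen h12 hp hX.1.1 hap hκ hγ D hξ)
  by_cases hfin : Finite (W.selmerGroupPInfty p)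
  · have hAFE : Ideal.map (IwasawaAlgebra.invol p) D.charIdeal = D.charIdeal :=
      hAFE3 W p hp3 hX hCM hap hs κ γ hκ hγ ε D
    by_cases hc : mu (kobayashiL ε Lplus Lminus) = 0 ∧ lam (kobayashiL ε Lplus Lminus) = 2
    · -- the `(0, 2)`-certified stratum
      by_cases hsm : ∃ (ℓ : ℕ) (_ : Fact ℓ.Prime), W.HasSplitMultiplicativeReductionAtPrime ℓ
      · -- a split multiplicative prime: the `T = 0` shadow is automatic (this gen)
        obtain ⟨ℓ, hℓ, hsplit⟩ := hsm
        exact lam_kobayashiL_le_lam_charGen_of_cert_of_split h12 hCK hK13 h5 h3 hp hX.1.1 hap hs hf hκ hγ hγ' hPP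
          hc.1 hc.2.le D hξ hAFE hfin hsplit
      · -- every multiplicative prime non-split: the shadow is asked
        have hns : ∀ (ℓ : ℕ) [Fact ℓ.Prime], ¬ W.HasSplitMultiplicativeReductionAtPrime ℓ :=
          fun ℓ _ hsl ↦ hsm ⟨ℓ, inferInstance, hsl⟩
        have hdvd := hshadow W p hp3 hX hCM hap hs hns ε κ γ hκ hγ hγ' f hf Lplus Lminus hPP hfin hc.1 hc.2
        exact lam_kobayashiL_le_lam_charGen_of_cert_of_not_surj h12 hCK hK13 h5 h3 hp hX.1.1 hap hs hf hκ hγ hγ' hPP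
          hc.1 hc.2.le D hξ hAFE hfin hdvd
    · -- rank `0`, certificate not `(0, 2)`: the widened door
      exact lam_kobayashiL_le_lam_charGen_of_afe_of_le_add_one h12 h41 hK13 hparW hp hX.1.1 hap hf hκ hγ hγ' hPP D
        hξ hAFE hfin (hres0 W p hp3 hX hCM hap hs ε κ γ hκ hγ hγ' f hf Lplus Lminus hPP hfin hc h2 D ξ hξ)
  · exact hres1 W p hp3 hX hCM hap hs ε κ γ hκ hγ hγ' f hf Lplus Lminus hPP hfin h2 D ξ hξ

end Summit.BirchSwinnertonDyer.BirchSwinnertonDyer.Theorems.SmallImageLambdaLowerThreeNsTamagawaResidue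

end
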